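import Summits.Ventures.HSemireg.WedgeHankelRecurrenceCompanionAlgebra

/-!
# Venture HSemireg — EVERY MULTIPLICATION MATRIX IS A POLYNOMIAL IN THE SHIFT MATRIX: `M_a = a(M_X)` for the multiplication matrices `M_a = mulResidueMat m a` of `K[X]/(m)` (N73),
# so **the regular representation `a ↦ M_a` is the evaluation `a ↦ a(M_X)` at the companion ∕ shift matrix, and all `M_a` commute** (`m` monic of degree `t + 1`)

HONEST FRAMING. Part of the Lean index of the computation cell `pub-hsemireg` (seat p10 gen 30, Sunday typer «UNIFORM-IN-n»).
LINEAR ALGEBRA OF HANKEL (catalecticant) MATRICES and of polynomials over a field ONLY: no variety, no cohomology theory, no sheaf, no Ext group and no semiregularity map is constructed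
here; nothing here says that HC / HC_CM / HC_AV holds; no Literature fact is declared or used.  Custodian versions as in `WedgeHankelSiegelIdeal` (1/3).

WHAT IS IN THE TREE.  N73: `mulResidueMat`, `mulResidueMat_apply`.  N91 (`WedgeHankelRecurrenceCompanionAlgebra`): `mulResidueMat_one`, `mulResidueMat_mul`, `mulResidueMat_X_pow`.  Mathlib: `Polynomial.add_modByMonic`,
`Polynomial.smul_modByMonic`, `Polynomial.induction_on'`, `Polynomial.aeval_C`, `Polynomial.aeval_X`, `Algebra.algebraMap_eq_smul_one`.
THIS FILE (namespace `Summit.Ventures.HSemireg.Wedge.HankelOuter` continued; CHAINED on N91; 0 definitions):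
* §649 `mulResidueMat_add`, `mulResidueMat_smul` (linearity in the residue, any `m`), `mulResidueMat_C` (`M_{C c} = c • 1`), **`mulResidueMat_eq_aeval`** (`M_a = aeval M_X a`), `mulResidueMat_comm`
  (`M_a M_b = M_b M_a`).
Nothing Ext-side.  New names only.
-/

open Module Polynomial
open scoped Matrix Polynomial

namespace Summit.Ventures.HSemireg.Wedge.HankelOuter

open Summit.Ventures.HSemireg.Wedge Summit.Ventures.HSemireg.Wedge.Hankel

variable (K : Type*) [Field K]

/-! ## §649. Every multiplication matrix is a polynomial in the shift matrix -/

/-- `M_{a+b} = M_a + M_b` (any `m`). -/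
theorem mulResidueMat_add (t : ℕ) (m a b : K[X]) : mulResidueMat K t m (a + b) = mulResidueMat K t m a + mulResidueMat K t m b := by
  ext k j
  simp only [mulResidueMat_apply, Matrix.add_apply, mul_add, Polynomial.add_modByMonic, Polynomial.coeff_add]

/-- `M_{c•a} = c • M_a` (any `m`). -/
theorem mulResidueMat_smul (t : ℕ) (m : K[X]) (c : K) (a : K[X]) : mulResidueMat K t m (c • a) = c • mulResidueMat K t m a := by
  ext k j
  simp only [mulResidueMat_apply, Matrix.smul_apply, mul_smul_comm, Polynomial.smul_modByMonic, Polynomial.coeff_smul, smul_eq_mul]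

/-- `M_{C c} = c • 1` (`m` monic of degree `t + 1`). -/
theorem mulResidueMat_C {t : ℕ} {m : K[X]} (hm : m.Monic) (hmd : m.natDegree = t + 1) (c : K) :
    mulResidueMat K t m (C c) = c • (1 : Matrix (Fin (t + 1)) (Fin (t + 1)) K) := by
  rw [← mul_one (C c), ← Polynomial.smul_eq_C_mul, mulResidueMat_smul, mulResidueMat_one K hm hmd]

/-- **`M_a = a(M_X)`: every multiplication matrix of `K[X]/(m)` is the value of its residue at the shift matrix** (`m` monic of degree `t + 1`): the regular representation is evaluation at the
companion matrix. -/
theorem mulResidueMat_eq_aeval {t : ℕ} {m : K[X]} (hm : m.Monic) (hmd : m.natDegree = t + 1) (a : K[X]) :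
    mulResidueMat K t m a = aeval (mulResidueMat K t m Polynomial.X) a := by
  induction a using Polynomial.induction_on' with
  | add p q hp hq => rw [mulResidueMat_add, hp, hq, map_add]
  | monomial n c =>
    rw [← Polynomial.C_mul_X_pow_eq_monomial, mulResidueMat_mul K hm hmd, mulResidueMat_C K hm hmd, mulResidueMat_X_pow K hm hmd, map_mul, Polynomial.aeval_C, map_pow,
      Polynomial.aeval_X, Algebra.algebraMap_eq_smul_one]

/-- all multiplication matrices commute: `M_a M_b = M_b M_a` (`m` monic of degree `t + 1`). -/
theorem mulResidueMat_comm {t : ℕ} {m : K[X]} (hm : m.Monic) (hmd : m.natDegree = t + 1) (a b : K[X]) :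
    mulResidueMat K t m a * mulResidueMat K t m b = mulResidueMat K t m b * mulResidueMat K t m a := by
  rw [← mulResidueMat_mul K hm hmd, ← mulResidueMat_mul K hm hmd, mul_comm]

end Summit.Ventures.HSemireg.Wedge.HankelOuter
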